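import Summits.QuantumFields.BalabanUV.Beta.FP.HorizontalBookkeepingDefectAveraged

/-!
# `BalabanUV.Beta.FP.HorizontalBookkeepingCov` — road «FP» for binder row D1, organisation γ, RULING R-FP-32 (repair (R2) of FINDING F-d1leaf01g10-1):
# THE TRUNCATED-TRANSPORT IDENTITY WITH **BOTH** THE (T0)- AND THE (T1)-DEFECT DISPLAYED — NO parity ∕ evenness hypothesis on the fine kernel `T` —
# and the (T1)-defect's size `N⁶·|t1Defect| ≤ 32·A₁·(c₁ + c_C)∕N` under the first-moment letter `|M₁(T c e)| ≤ A₁∕N²` and the row's profile letters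

HONEST DEPENDENCY (page 1, mandatory): continuum YM on T⁴ ⇐ BetaPertH ∧ nine spine estimates (0/9 proved); BetaPertH ⇐ (D1) ∧ (D4) ∧
CAP+tail; G-an2-4 gates asym, D1 and NE2/3/4.  HONEST FRAMING (cell contract, verbatim): «discharging `BetaPertH` makes Bałaban's UV
stability UNCONDITIONAL — a real constructive-QFT result; it is NOT the continuum limit and NOT the Clay problem.»  THIS MODULE composes BY NAME the
tree's [folklore] lattice bookkeeping — leaf-02-g5's NINE-TERM MASTER IDENTITY `HorizontalBookkeeping.decimatedSum_second_moment_hasSum_lattice_nine` (NO hypothesis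
on `T`), `hasSum_coarse`∕`hasSum_decimate_iff` inside it, `DressedMomentNormalisation.hasSum_total_of_constReproSum`, the `AbsMoment₂` package, and (§3) the letter
calculus of `HorizontalBookkeepingDefectAveraged` ∕ `HorizontalBookkeepingTailLetters.letter_of_expL1`.  It cites nothing, mints no `Prop` fact, 0 sorry; its one
`def` (`t1Defect`) is data (an explicit finite sum of products of moments), the sibling of `HorizontalBookkeeping.t0Defect`.  Every analytic input is a HYPOTHESIS
displayed in the signatures.  NOT (H1), NOT hbook, NOT hasym, NOT D1, NOT BetaPertH, NOT continuum, NOT Clay.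

ABSOLUTE RULE (cell charter, verbatim): «No internally-minted statement may enter as a cited fact. Every hypothesis is either kernel-proved in this
package or a verbatim quotation of a PUBLISHED theorem with page reference. The manuscript(s) under audit are NOT citable for their own disputed
steps — they are the thing under adjudication; programme-internal (2001/route/tribunal) claims are never citable.»

WHY (F-d1leaf01g10-1 ∕ owner ERRATUM E-FP-8-2 + RULING R-FP-32, journal 2026-08-21T03:4xZ).  `HorizontalBookkeeping.secondMoment_dressedEntry_hasSum_lattice_t0Defect` kills the
four `m₁`-terms of the nine-term identity by the letter `heven` (entrywise EVENNESS of `T`); for a kernel with the printed reflection covariance (5.7) that letter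
forces every off-diagonal channel to vanish (`FP/EvenKernelNoGo`), so the ENDs built on it have an unfillable socket at the road's use case.  The repair of record
(R2): keep the `m₁`-terms.  They are EXACT (no Taylor expansion) and, for the truncated kernel `truncK K N` of a (5.7)-covariant `K` with sextic decay, SMALL:
`|M₁^κ(truncK K N c e)| ≤ 80C∕(N+1)²` (`FP/TruncatedFirstMoment`), whence `N⁶·|t1Defect| = O(1∕N)` in the row's profile currency (§2–§3 below).

CONTENT.
* §1 (any `d`) [our object] **`t1Defect N w T Cw κ λ a b`** `:= Σ_{c,e} [σ_{ca}·(m₁κ(T c e)·n₁λ(w e b) + m₁λ(T c e)·n₁κ(w e b)) − (Cw c a λ·m₁κ(T c e) + Cw c a κ·m₁λ(T c e))·(N^d·σ′_{eb})]`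
  (`σ_{ca} = [c=a]·N^{−(d+1)}`, `σ′_{eb} = [e=b]·N^{−(d+1)}`, `m₁κ(T) = Σ' t, t κ • T t`, `n₁κ(w) = Σ' x, x κ • w x`); `t1Defect_eq_zero_of_T1` (consistency with the (T1) case);
  **`secondMoment_dressedEntry_hasSum_lattice_t0t1Defect`** — the decimated second moment of the `(a,b)` entry of `Wᵀ·T·W` is
  `N^{−(d+2)}·M₂^{κλ}(T a b) + t0Defect + t1Defect` under (L0∞)∕(L1∞)∕`AbsMoment₂` ONLY (no (T0), no (T1), no evenness); `abs_t1Defect_le` (abstract size).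
* §2 (`d = 4`, coarse units) **`hasSum_coarse_secondMoment_t0t1Defect`** (`Σ_z z_κz_λ·(N⁸·dressedEntry … (N•z)) = M₂(T a b) + N⁶·(t0Defect + t1Defect)`),
  **`pow_six_mul_abs_t1Defect_le`** (`|m₁(T c e)| ≤ A₁∕N²`, `|n₁(w)| ≤ c₁`, `|Cw| ≤ c_C∕N⁴` ⟹ `N⁶·|t1Defect| ≤ 32·A₁·(c₁ + c_C)∕N`),
  **`hasSum_coarse_secondMoment_truncK_t0t1`** (the symmetric truncation `truncK K R`: NO hypothesis on `K` at all — finite support).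
* §3 the (T1)-defect in the LETTER and exp-ℓ¹ currencies of `HorizontalBookkeepingDefectAveraged`: **`pow_six_mul_abs_t1Defect_le_of_letters`** (`≤ 64·A₁·ℓ₁∕N`),
  **`pow_six_mul_abs_t1Defect_le_of_expL1`** (`≤ 64·A₁·(c·e^δ∕δ)∕N ≤ 64·A₁·(c·e^δ∕δ)`, N-FREE).
The K-side letter `A₁ := 80·C` is `TruncatedFirstMoment.abs_firstMoment_truncK_le_of_cov_flip'` (from `AxisReflectionCovariant (flipK K)` + (K6)); it is NOT imported here
(the downstream twins `HorizontalTailAssemblyCov` ∕ the owner's `HorizontalRemainderPerfectCov` plug it), exactly as `t0Defect`'s `A := 40·C` comes from `TruncatedZerothMoment`.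
Unit `b2b-balaban-beta-d1-formalise-leaf-01` (gen 10), assignment (C-up) of R-FP-32.
-/

noncomputable section

namespace Summit.QuantumFields.BalabanUV.Beta.FP.HorizontalBookkeepingCov

open Finset Filter Topology
open scoped BigOperators
open Literature.MathematicalPhysics.QuantumFieldTheory.Balaban1983to89
open Literature.MathematicalPhysics.QuantumFieldTheory.Balaban1983to89.Beta
open DecimatedMomentSummable (ConstReproSum LinReproSum AbsMoment₂ dressedSum)
open DressedMomentNormalisation (EKer dressedEntry hasSum_total_of_constReproSum)
open B12Sec2to5 (l1 l1_nonneg abs_coord_le_l1)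
open Summit.QuantumFields.BalabanUV.Beta.FP.HorizontalBookkeeping (decimatedSum_second_moment_hasSum_lattice_nine t0Defect truncK truncK_apply
  absMoment₂_truncK tsum_smul_truncK_eq_sum)
open Summit.QuantumFields.BalabanUV.Beta.FP.HorizontalBookkeepingTailLetters (letter_of_expL1)
open Summit.QuantumFields.BalabanUV.Beta.FP.HorizontalBookkeepingDefectAveraged (abs_affineConst_le_of_letter summable_weightOne_of_weightTwo)

variable {d N : ℕ}

/-! ## §1 The (T1)-defect and the identity with both defects displayed -/

/-- [our object] **THE (T1)-DEFECT** of the decimated second moment of the `(a, b)` entry of `Wᵀ·T·W`: the four `m₁`-terms of the nine-term identity, summed over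
the fine channels `(c,e)` — `Σ_{c,e} [σ_{ca}·(M₁^κ(T c e)·M₁^λ(w e b) + M₁^λ(T c e)·M₁^κ(w e b)) − (Cw c a λ·M₁^κ(T c e) + Cw c a κ·M₁^λ(T c e))·(N^d·σ′_{eb})]`
with the Kronecker masses `σ_{ca} = δ_{ca}N^{−(d+1)}`, `σ′_{eb} = δ_{eb}N^{−(d+1)}`.  It VANISHES when every first moment `M₁^κ(T c e)` does ((T1)); nothing here assumes that. -/
def t1Defect (N : ℕ) (w T : EKer d) (Cw : Fin d → Fin d → Fin d → ℝ) (κ l a b : Fin d) : ℝ :=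
  ∑ c, ∑ e, ((if c = a then (((N : ℝ) ^ (d + 1))⁻¹) else 0) * ((∑' t, t κ • T c e t) * (∑' x, x l • w e b x) + (∑' t, t l • T c e t) * (∑' x, x κ • w e b x))
    - (Cw c a l * (∑' t, t κ • T c e t) + Cw c a κ * (∑' t, t l • T c e t)) * ((N : ℝ) ^ d * (if e = b then (((N : ℝ) ^ (d + 1))⁻¹) else 0)))

/-- [folklore] CONSISTENCY: under (T1) (`M₁^μ(T c e) = 0` for all `c, e, μ`) the (T1)-defect vanishes. -/
theorem t1Defect_eq_zero_of_T1 (N : ℕ) (w T : EKer d) (Cw : Fin d → Fin d → Fin d → ℝ) (κ l a b : Fin d)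
    (hT1 : ∀ c e (μ : Fin d), ∑' t : Fin d → ℤ, t μ • T c e t = 0) : t1Defect N w T Cw κ l a b = 0 := by
  simp only [t1Defect, hT1, zero_mul, mul_zero, add_zero, sub_zero, Finset.sum_const_zero]

/-- **THE DECIMATED SECOND MOMENT OF AN ENTRY OF THE DRESSED KERNEL, (T0)- AND (T1)-DEFECTS DISPLAYED** (spec normalisation; NO (T0), NO (T1), NO evenness):
entrywise (L0∞) with the Kronecker masses `δ_{κl}·N^{−(d+1)}`, entrywise (L1∞) with constants `Cw κ l`, absolute second moments of `w` and `T`; then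
`z ↦ (N² z_κ z_λ) • K_{ab}(N z)` has the sum `N^{−(d+2)}·Σ'_t t_κt_λ T a b t + t0Defect + t1Defect`. [folklore] -/
theorem secondMoment_dressedEntry_hasSum_lattice_t0t1Defect (hN : 0 < N) (w T : EKer d) (Cw : Fin d → Fin d → Fin d → ℝ)
    (hw0 : ∀ κ l, ConstReproSum N (w κ l) (if κ = l then (((N : ℝ) ^ (d + 1))⁻¹) else 0))
    (hw1 : ∀ κ l, LinReproSum N (w κ l) (Cw κ l))
    (hwA : ∀ κ l, AbsMoment₂ (w κ l)) (hTA : ∀ c e, AbsMoment₂ (T c e)) (κ lam a b : Fin d) :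
    HasSum (fun z : Fin d → ℤ => ((N : ℤ) ^ 2 * (z κ * z lam)) • dressedEntry w T ((N : ℤ) • z) a b)
      ((((N : ℝ) ^ (d + 2))⁻¹) * (∑' t, (t κ * t lam) • T a b t) + t0Defect N w T Cw κ lam a b + t1Defect N w T Cw κ lam a b) := by
  have hNne : N ≠ 0 := hN.ne'
  -- the scalar nine-term identity for each pair (c, e), with `n₀ = N^d · σ′`, regrouped as MAIN + (T0-part + T1-part)
  have hce : ∀ c e : Fin d,
      HasSum (fun z : Fin d → ℤ => ((N : ℤ) ^ 2 * (z κ * z lam)) • dressedSum (w c a) (T c e) (w e b) ((N : ℤ) • z))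
        ((if c = a then (((N : ℝ) ^ (d + 1))⁻¹) else 0) * (∑' t, (t κ * t lam) • T c e t)
            * ((N : ℝ) ^ d * (if e = b then (((N : ℝ) ^ (d + 1))⁻¹) else 0))
          + ((∑' t, T c e t) * ((if c = a then (((N : ℝ) ^ (d + 1))⁻¹) else 0) * (∑' x, (x κ * x lam) • w e b x)
              - Cw c a lam * (∑' x, x κ • w e b x) - Cw c a κ * (∑' x, x lam • w e b x)
              + (∑' u, (u κ * u lam) • w c a u) * (if e = b then (((N : ℝ) ^ (d + 1))⁻¹) else 0))
            + ((if c = a then (((N : ℝ) ^ (d + 1))⁻¹) else 0) * ((∑' t, t κ • T c e t) * (∑' x, x lam • w e b x)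
                + (∑' t, t lam • T c e t) * (∑' x, x κ • w e b x))
              - (Cw c a lam * (∑' t, t κ • T c e t) + Cw c a κ * (∑' t, t lam • T c e t))
                * ((N : ℝ) ^ d * (if e = b then (((N : ℝ) ^ (d + 1))⁻¹) else 0))))) := by
    intro c e
    have h := decimatedSum_second_moment_hasSum_lattice_nine hNne (w c a) (T c e) (w e b) (hw0 c a) (hw1 c a) (hw0 e b)
      (hwA c a) (hTA c e) (hwA e b) κ lam
    rw [(hasSum_total_of_constReproSum hN (hw0 e b)).tsum_eq] at h
    convert h using 1
    ring
  have hs := hasSum_sum (s := (Finset.univ : Finset (Fin d)))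
    (fun c _ => hasSum_sum (s := (Finset.univ : Finset (Fin d))) (fun e _ => hce c e))
  -- collapse the Kronecker masses in the main term; the two defect parts are `t0Defect`, `t1Defect` verbatim
  have hmain : ∑ c, ∑ e, (if c = a then (((N : ℝ) ^ (d + 1))⁻¹) else 0) * (∑' t, (t κ * t lam) • T c e t)
        * ((N : ℝ) ^ d * (if e = b then (((N : ℝ) ^ (d + 1))⁻¹) else 0))
      = (((N : ℝ) ^ (d + 2))⁻¹) * (∑' t, (t κ * t lam) • T a b t) := by
    simp only [mul_ite, mul_zero, ite_mul, zero_mul, Finset.sum_ite_eq', Finset.mem_univ, if_true]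
    have hN' : (N : ℝ) ≠ 0 := by exact_mod_cast hNne
    field_simp
    ring
  have hval : ∑ c, ∑ e, ((if c = a then (((N : ℝ) ^ (d + 1))⁻¹) else 0) * (∑' t, (t κ * t lam) • T c e t)
        * ((N : ℝ) ^ d * (if e = b then (((N : ℝ) ^ (d + 1))⁻¹) else 0))
          + ((∑' t, T c e t) * ((if c = a then (((N : ℝ) ^ (d + 1))⁻¹) else 0) * (∑' x, (x κ * x lam) • w e b x)
              - Cw c a lam * (∑' x, x κ • w e b x) - Cw c a κ * (∑' x, x lam • w e b x)
              + (∑' u, (u κ * u lam) • w c a u) * (if e = b then (((N : ℝ) ^ (d + 1))⁻¹) else 0))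
            + ((if c = a then (((N : ℝ) ^ (d + 1))⁻¹) else 0) * ((∑' t, t κ • T c e t) * (∑' x, x lam • w e b x)
                + (∑' t, t lam • T c e t) * (∑' x, x κ • w e b x))
              - (Cw c a lam * (∑' t, t κ • T c e t) + Cw c a κ * (∑' t, t lam • T c e t))
                * ((N : ℝ) ^ d * (if e = b then (((N : ℝ) ^ (d + 1))⁻¹) else 0)))))
      = (((N : ℝ) ^ (d + 2))⁻¹) * (∑' t, (t κ * t lam) • T a b t) + t0Defect N w T Cw κ lam a b + t1Defect N w T Cw κ lam a b := by
    simp only [Finset.sum_add_distrib]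
    rw [hmain]
    simp only [HorizontalBookkeeping.t0Defect, t1Defect]
    ring
  rw [hval] at hs
  refine hs.congr_fun (fun z => ?_)
  simp only [dressedEntry, Finset.smul_sum]

/-- [folklore] **ABSTRACT SIZE OF THE (T1)-DEFECT**: with `|M₁^μ(T c e)| ≤ A₁` (all `c, e`, `μ ∈ {κ, λ}`), `|M₁^μ(w c e)| ≤ B₁`, `|Cw c e μ| ≤ B_C`:
`|t1Defect| ≤ d²·(2·N^{−(d+1)}·A₁·B₁ + 2·B_C·A₁·(N^d·N^{−(d+1)}))`. -/
theorem abs_t1Defect_le (w T : EKer d) (Cw : Fin d → Fin d → Fin d → ℝ) (κ l a b : Fin d) {A₁ B₁ BC : ℝ}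
    (hA1 : ∀ c e (μ : Fin d), |∑' t : Fin d → ℤ, t μ • T c e t| ≤ A₁)
    (hB1 : ∀ c e (μ : Fin d), |∑' x : Fin d → ℤ, x μ • w c e x| ≤ B₁) (hBC : ∀ c e (μ : Fin d), |Cw c e μ| ≤ BC) :
    |t1Defect N w T Cw κ l a b|
      ≤ (d : ℝ) ^ 2 * (2 * (((N : ℝ) ^ (d + 1))⁻¹) * A₁ * B₁ + 2 * BC * A₁ * ((N : ℝ) ^ d * (((N : ℝ) ^ (d + 1))⁻¹))) := by
  have hA0 : 0 ≤ A₁ := (abs_nonneg _).trans (hA1 a b κ)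
  have hB10 : 0 ≤ B₁ := (abs_nonneg _).trans (hB1 a b κ)
  have hBC0 : 0 ≤ BC := (abs_nonneg _).trans (hBC a b κ)
  have hNi : 0 ≤ (((N : ℝ) ^ (d + 1))⁻¹) := by positivity
  have hNd : 0 ≤ (N : ℝ) ^ d * (((N : ℝ) ^ (d + 1))⁻¹) := by positivity
  have hδ : ∀ (c e : Fin d), |(if c = e then (((N : ℝ) ^ (d + 1))⁻¹) else 0)| ≤ (((N : ℝ) ^ (d + 1))⁻¹) := by
    intro c e; split_ifs <;> simp [abs_of_nonneg hNi, hNi]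
  have hδ' : ∀ (c e : Fin d), |(N : ℝ) ^ d * (if c = e then (((N : ℝ) ^ (d + 1))⁻¹) else 0)| ≤ (N : ℝ) ^ d * (((N : ℝ) ^ (d + 1))⁻¹) := by
    intro c e
    rw [abs_mul, abs_of_nonneg (by positivity : (0 : ℝ) ≤ (N : ℝ) ^ d)]
    exact mul_le_mul_of_nonneg_left (hδ c e) (by positivity)
  unfold t1Defect
  calc |∑ c, ∑ e, ((if c = a then (((N : ℝ) ^ (d + 1))⁻¹) else 0)
            * ((∑' t, t κ • T c e t) * (∑' x, x l • w e b x) + (∑' t, t l • T c e t) * (∑' x, x κ • w e b x))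
          - (Cw c a l * (∑' t, t κ • T c e t) + Cw c a κ * (∑' t, t l • T c e t)) * ((N : ℝ) ^ d * (if e = b then (((N : ℝ) ^ (d + 1))⁻¹) else 0)))|
      ≤ ∑ c, ∑ e, (2 * (((N : ℝ) ^ (d + 1))⁻¹) * A₁ * B₁ + 2 * BC * A₁ * ((N : ℝ) ^ d * (((N : ℝ) ^ (d + 1))⁻¹))) := by
        refine (abs_sum_le_sum_abs _ _).trans (sum_le_sum fun c _ => (abs_sum_le_sum_abs _ _).trans (sum_le_sum fun e _ => ?_))
        have t1 : |(if c = a then (((N : ℝ) ^ (d + 1))⁻¹) else 0)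
              * ((∑' t, t κ • T c e t) * (∑' x, x l • w e b x) + (∑' t, t l • T c e t) * (∑' x, x κ • w e b x))|
            ≤ (((N : ℝ) ^ (d + 1))⁻¹) * (A₁ * B₁ + A₁ * B₁) := by
          rw [abs_mul]
          refine mul_le_mul (hδ c a) ?_ (abs_nonneg _) hNi
          refine (abs_add_le _ _).trans (add_le_add ?_ ?_)
          · rw [abs_mul]; exact mul_le_mul (hA1 c e κ) (hB1 e b l) (abs_nonneg _) hA0
          · rw [abs_mul]; exact mul_le_mul (hA1 c e l) (hB1 e b κ) (abs_nonneg _) hA0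
        have t2 : |(Cw c a l * (∑' t, t κ • T c e t) + Cw c a κ * (∑' t, t l • T c e t))
              * ((N : ℝ) ^ d * (if e = b then (((N : ℝ) ^ (d + 1))⁻¹) else 0))|
            ≤ (BC * A₁ + BC * A₁) * ((N : ℝ) ^ d * (((N : ℝ) ^ (d + 1))⁻¹)) := by
          rw [abs_mul]
          refine mul_le_mul ?_ (hδ' e b) (abs_nonneg _) (by positivity)
          refine (abs_add_le _ _).trans (add_le_add ?_ ?_)
          · rw [abs_mul]; exact mul_le_mul (hBC c a l) (hA1 c e κ) (abs_nonneg _) hBC0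
          · rw [abs_mul]; exact mul_le_mul (hBC c a κ) (hA1 c e l) (abs_nonneg _) hBC0
        calc _ ≤ |(if c = a then (((N : ℝ) ^ (d + 1))⁻¹) else 0)
              * ((∑' t, t κ • T c e t) * (∑' x, x l • w e b x) + (∑' t, t l • T c e t) * (∑' x, x κ • w e b x))|
              + |(Cw c a l * (∑' t, t κ • T c e t) + Cw c a κ * (∑' t, t l • T c e t))
              * ((N : ℝ) ^ d * (if e = b then (((N : ℝ) ^ (d + 1))⁻¹) else 0))| := abs_sub _ _
          _ ≤ (((N : ℝ) ^ (d + 1))⁻¹) * (A₁ * B₁ + A₁ * B₁) + (BC * A₁ + BC * A₁) * ((N : ℝ) ^ d * (((N : ℝ) ^ (d + 1))⁻¹)) :=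
              add_le_add t1 t2
          _ = 2 * (((N : ℝ) ^ (d + 1))⁻¹) * A₁ * B₁ + 2 * BC * A₁ * ((N : ℝ) ^ d * (((N : ℝ) ^ (d + 1))⁻¹)) := by ring
    _ = (d : ℝ) ^ 2 * (2 * (((N : ℝ) ^ (d + 1))⁻¹) * A₁ * B₁ + 2 * BC * A₁ * ((N : ℝ) ^ d * (((N : ℝ) ^ (d + 1))⁻¹))) := by
        rw [sum_const, card_univ, Fintype.card_fin, nsmul_eq_mul, sum_const, card_univ, Fintype.card_fin, nsmul_eq_mul]; ring

/-! ## §2 `d = 4`: coarse units, the profile bound, the symmetric truncation -/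

section Four

open DyadicShell (Pt supNorm)
open Literature.Probability.LatticeModels (box)

variable {N : ℕ}

/-- **COARSE UNITS** (`d = 4`): `Σ_z z_κ z_λ · (N⁸ · K_{ab}(N z)) = M₂^{κλ}(T a b) + N⁶·(t0Defect + t1Defect)` — NO parity hypothesis on `T`. [folklore] -/
theorem hasSum_coarse_secondMoment_t0t1Defect (hN : 0 < N) (w T : EKer 4) (Cw : Fin 4 → Fin 4 → Fin 4 → ℝ)
    (hw0 : ∀ κ l, ConstReproSum N (w κ l) (if κ = l then (((N : ℝ) ^ (4 + 1))⁻¹) else 0))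
    (hw1 : ∀ κ l, LinReproSum N (w κ l) (Cw κ l))
    (hwA : ∀ κ l, AbsMoment₂ (w κ l)) (hTA : ∀ c e, AbsMoment₂ (T c e)) (κ lam a b : Fin 4) :
    HasSum (fun z : Fin 4 → ℤ => ((z κ * z lam : ℤ) : ℝ) * ((N : ℝ) ^ 8 * dressedEntry w T ((N : ℤ) • z) a b))
      ((∑' t, (t κ * t lam) • T a b t) + (N : ℝ) ^ 6 * (t0Defect N w T Cw κ lam a b + t1Defect N w T Cw κ lam a b)) := by
  have h := (secondMoment_dressedEntry_hasSum_lattice_t0t1Defect hN w T Cw hw0 hw1 hwA hTA κ lam a b).mul_left ((N : ℝ) ^ 6)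
  have hN' : (N : ℝ) ≠ 0 := by exact_mod_cast hN.ne'
  have hv : (N : ℝ) ^ 6 * ((((N : ℝ) ^ (4 + 2))⁻¹) * (∑' t : Fin 4 → ℤ, (t κ * t lam) • T a b t) + t0Defect N w T Cw κ lam a b
        + t1Defect N w T Cw κ lam a b)
      = (∑' t : Fin 4 → ℤ, (t κ * t lam) • T a b t) + (N : ℝ) ^ 6 * (t0Defect N w T Cw κ lam a b + t1Defect N w T Cw κ lam a b) := by
    field_simp
    ring
  rw [hv] at h
  refine h.congr_fun (fun z => ?_)
  simp only [zsmul_eq_mul, Int.cast_mul, Int.cast_pow, Int.cast_natCast]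
  ring

/-- **THE (T1)-DEFECT IS `O(1∕N)` IN COARSE UNITS UNDER THE FIRST-MOMENT LETTER** (`d = 4`): if `|M₁^μ(T c e)| ≤ A₁∕N²` (for `T = truncK K N` of a (5.7)-covariant
`K` with sextic decay: `TruncatedFirstMoment.abs_firstMoment_truncK_le_of_cov_flip'`, `A₁ = 80C`), the transport weights have first moments `≤ c₁` and affine constants
`≤ c_C∕N⁴` (the row's N-UNIFORM profile letters), then `N⁶·|t1Defect| ≤ 32·A₁·(c₁ + c_C)∕N`. [folklore] -/
theorem pow_six_mul_abs_t1Defect_le (hN : 0 < N) (w T : EKer 4) (Cw : Fin 4 → Fin 4 → Fin 4 → ℝ) (κ l a b : Fin 4) {A₁ c₁ cC : ℝ}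
    (hA1 : ∀ c e (μ : Fin 4), |∑' t : Pt, t μ • T c e t| ≤ A₁ / (N : ℝ) ^ 2)
    (hB1 : ∀ c e (μ : Fin 4), |∑' x : Pt, x μ • w c e x| ≤ c₁) (hBC : ∀ c e (μ : Fin 4), |Cw c e μ| ≤ cC / (N : ℝ) ^ 4) :
    (N : ℝ) ^ 6 * |t1Defect N w T Cw κ l a b| ≤ 32 * A₁ * (c₁ + cC) / N := by
  have hN' : (0 : ℝ) < N := by exact_mod_cast hN
  have h := abs_t1Defect_le (N := N) w T Cw κ l a b hA1 hB1 hBC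
  have e : ((4 : ℕ) : ℝ) ^ 2 * (2 * (((N : ℝ) ^ (4 + 1))⁻¹) * (A₁ / (N : ℝ) ^ 2) * c₁
        + 2 * (cC / (N : ℝ) ^ 4) * (A₁ / (N : ℝ) ^ 2) * ((N : ℝ) ^ 4 * (((N : ℝ) ^ (4 + 1))⁻¹)))
      = (32 * A₁ * (c₁ + cC) / N) / (N : ℝ) ^ 6 := by
    field_simp
    ring
  rw [e, le_div_iff₀ (by positivity)] at h
  linarith

/-- [folklore] The `N`-free form: `N⁶·|t1Defect| ≤ 32·A₁·(c₁ + c_C)` for `N ≥ 1` (when the three letter constants are nonnegative). -/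
theorem pow_six_mul_abs_t1Defect_le' (hN : 0 < N) (w T : EKer 4) (Cw : Fin 4 → Fin 4 → Fin 4 → ℝ) (κ l a b : Fin 4) {A₁ c₁ cC : ℝ}
    (hA1 : ∀ c e (μ : Fin 4), |∑' t : Pt, t μ • T c e t| ≤ A₁ / (N : ℝ) ^ 2)
    (hB1 : ∀ c e (μ : Fin 4), |∑' x : Pt, x μ • w c e x| ≤ c₁) (hBC : ∀ c e (μ : Fin 4), |Cw c e μ| ≤ cC / (N : ℝ) ^ 4) :
    (N : ℝ) ^ 6 * |t1Defect N w T Cw κ l a b| ≤ 32 * A₁ * (c₁ + cC) := by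
  have hN1 : (1 : ℝ) ≤ N := by exact_mod_cast hN
  have hA0 : 0 ≤ A₁ := by
    have h := (abs_nonneg _).trans (hA1 a b κ)
    exact (div_nonneg_iff.mp h).elim (fun h => h.1) fun h => absurd h.2 (not_le.mpr (by positivity))
  have hc0 : 0 ≤ c₁ := (abs_nonneg _).trans (hB1 a b κ)
  have hC0 : 0 ≤ cC := by
    have h := (abs_nonneg _).trans (hBC a b κ)
    exact (div_nonneg_iff.mp h).elim (fun h => h.1) fun h => absurd h.2 (not_le.mpr (by positivity))
  refine (pow_six_mul_abs_t1Defect_le hN w T Cw κ l a b hA1 hB1 hBC).trans ?_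
  rw [div_le_iff₀ (by positivity)]
  have : 0 ≤ 32 * A₁ * (c₁ + cC) := by positivity
  nlinarith

/-- **THE SYMMETRIC TRUNCATION, BOTH DEFECTS DISPLAYED — NO HYPOTHESIS ON `K`** (`d = 4`, coarse units): for transport weights `w` with the Kronecker masses (L0∞),
affine constants `Cw` (L1∞) and absolute second moments, and ANY kernel `K`, the decimated coarse second moment of the `(a, b)` entry of `Wᵀ·(K·1_{‖·‖∞≤R})·W` is
`M₂^{κλ}(K·1_{≤R})_{ab} + N⁶·(t0Defect + t1Defect)` (the truncated kernel has finite support, so `AbsMoment₂` is free).  The twin of leaf-02-g5's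
`hasSum_coarse_secondMoment_truncK` WITHOUT its `heven`. [folklore] -/
theorem hasSum_coarse_secondMoment_truncK_t0t1 (hN : 0 < N) (w : EKer 4) (K : EKer 4) (R : ℕ) (Cw : Fin 4 → Fin 4 → Fin 4 → ℝ)
    (hw0 : ∀ κ l, ConstReproSum N (w κ l) (if κ = l then (((N : ℝ) ^ (4 + 1))⁻¹) else 0))
    (hw1 : ∀ κ l, LinReproSum N (w κ l) (Cw κ l)) (hwA : ∀ κ l, AbsMoment₂ (w κ l)) (κ lam a b : Fin 4) :
    HasSum (fun z : Fin 4 → ℤ => ((z κ * z lam : ℤ) : ℝ) * ((N : ℝ) ^ 8 * dressedEntry w (truncK K R) ((N : ℤ) • z) a b))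
      ((∑ t ∈ box 4 R, (t κ * t lam) • truncK K R a b t)
        + (N : ℝ) ^ 6 * (t0Defect N w (truncK K R) Cw κ lam a b + t1Defect N w (truncK K R) Cw κ lam a b)) := by
  rw [← tsum_smul_truncK_eq_sum]
  exact hasSum_coarse_secondMoment_t0t1Defect hN w (truncK K R) Cw hw0 hw1 hwA (fun c e => absMoment₂_truncK K R c e) κ lam a b

end Four

/-! ## §3 The (T1)-defect in the letter and exp-ℓ¹ currencies -/

section Letters

open DyadicShell (Pt supNorm)

variable {N : ℕ}

/-- **THE (T1)-DEFECT BOUND IN THE LETTER CURRENCY** (no sup profile): (L1∞) constants `Cw`, the letter `Σ'(|x|₁+1)|w κ l x| ≤ ℓ₁` (summable), a middle factor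
with `|M₁^μ(T c e)| ≤ A₁∕N²` (`N ≥ 1`) ⟹ `N⁶·|t1Defect N w T Cw κ l a b| ≤ 64·A₁·ℓ₁∕N` — §2 with `hB1 ≤ ℓ₁`, `hBC ≤ ℓ₁∕N⁴`
(`HorizontalBookkeepingDefectAveraged.abs_affineConst_le_of_letter`). [folklore] -/
theorem pow_six_mul_abs_t1Defect_le_of_letters {w T : EKer 4} {Cw : Fin 4 → Fin 4 → Fin 4 → ℝ} {ℓ₁ A₁ : ℝ}
    (hN : 1 ≤ N) (hw1 : ∀ κ l, LinReproSum N (w κ l) (Cw κ l))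
    (hwS1 : ∀ κ l, Summable fun x => (l1 x + 1) * |w κ l x|)
    (hL1 : ∀ κ l, ∑' x, (l1 x + 1) * |w κ l x| ≤ ℓ₁)
    (hA1 : ∀ c e (μ : Fin 4), |∑' t : Pt, t μ • T c e t| ≤ A₁ / (N : ℝ) ^ 2) (κ l a b : Fin 4) :
    (N : ℝ) ^ 6 * |t1Defect N w T Cw κ l a b| ≤ 64 * A₁ * ℓ₁ / N := by
  have hN0 : 0 < N := hN
  have hB1 : ∀ c' e (μ : Fin 4), |∑' x, x μ • w c' e x| ≤ ℓ₁ := by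
    intro c' e μ
    have hpt : ∀ x : Pt, ‖x μ • w c' e x‖ ≤ (l1 x + 1) * |w c' e x| := by
      intro x
      rw [zsmul_eq_mul, Real.norm_eq_abs, abs_mul]
      exact mul_le_mul_of_nonneg_right ((abs_coord_le_l1 x μ).trans (by linarith)) (abs_nonneg _)
    have h1 : ‖∑' x : Pt, x μ • w c' e x‖ ≤ ∑' x : Pt, (l1 x + 1) * |w c' e x| :=
      tsum_of_norm_bounded (hwS1 c' e).hasSum hpt
    rw [Real.norm_eq_abs] at h1
    exact h1.trans (hL1 c' e)
  have hBC : ∀ c' e (μ : Fin 4), |Cw c' e μ| ≤ ℓ₁ / (N : ℝ) ^ 4 := fun c' e μ =>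
    abs_affineConst_le_of_letter hN (hw1 c' e) (hwS1 c' e) (hL1 c' e) μ
  refine (pow_six_mul_abs_t1Defect_le hN0 w T Cw κ l a b hA1 hB1 hBC).trans (le_of_eq ?_)
  ring

/-- **THE (T1)-DEFECT BOUND IN THE EXPONENTIALLY WEIGHTED ℓ¹ CURRENCY**: (L1∞) constants `Cw`, `Σ'_x e^{(δ/N)|x|₁}|w κ l x| ≤ c/N` (summable, `δ > 0`),
`|M₁^μ(T c e)| ≤ A₁/N²` (`N ≥ 1`) ⟹ `N⁶·|t1Defect N w T Cw κ l a b| ≤ 64·A₁·(c·e^δ/δ)/N` — §3 at the letter `ℓ₁ = c·e^δ/δ` of `letter_of_expL1` (`k = 1`). [folklore] -/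
theorem pow_six_mul_abs_t1Defect_le_of_expL1 {w T : EKer 4} {Cw : Fin 4 → Fin 4 → Fin 4 → ℝ} {c δ A₁ : ℝ}
    (hN : 1 ≤ N) (hδ : 0 < δ) (hw1 : ∀ κ l, LinReproSum N (w κ l) (Cw κ l))
    (hwE : ∀ κ l, Summable fun x => Real.exp (δ / N * l1 x) * |w κ l x|)
    (hwEb : ∀ κ l, ∑' x, Real.exp (δ / N * l1 x) * |w κ l x| ≤ c / N)
    (hA1 : ∀ c' e (μ : Fin 4), |∑' t : Pt, t μ • T c' e t| ≤ A₁ / (N : ℝ) ^ 2) (κ l a b : Fin 4) :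
    (N : ℝ) ^ 6 * |t1Defect N w T Cw κ l a b| ≤ 64 * A₁ * (c * Real.exp δ / δ) / N := by
  have hwS : ∀ κ' l', Summable fun x => (l1 x + 1) ^ 2 * |w κ' l' x| := fun κ' l' =>
    (letter_of_expL1 (D := 4) hδ hN (hwE κ' l') (hwEb κ' l') 2).1
  have hwS1 : ∀ κ' l', Summable fun x => (l1 x + 1) * |w κ' l' x| := fun κ' l' => summable_weightOne_of_weightTwo (hwS κ' l')
  have hL1 : ∀ κ' l', ∑' x, (l1 x + 1) * |w κ' l' x| ≤ c * Real.exp δ / δ := by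
    intro κ' l'
    have h := (letter_of_expL1 (D := 4) hδ hN (hwE κ' l') (hwEb κ' l') 1).2
    simp only [pow_one, Nat.factorial_one, Nat.cast_one, one_mul] at h
    refine h.trans (le_of_eq ?_)
    field_simp
  exact pow_six_mul_abs_t1Defect_le_of_letters hN hw1 hwS1 hL1 hA1 κ l a b

/-- **THE N-FREE FORM**: under the same letters, `N⁶·|t1Defect| ≤ 64·A₁·(c·e^δ/δ)` (`N ≥ 1`; `A₁, c ≥ 0` are forced by the letters). [folklore] -/
theorem pow_six_mul_abs_t1Defect_le_of_expL1' {w T : EKer 4} {Cw : Fin 4 → Fin 4 → Fin 4 → ℝ} {c δ A₁ : ℝ}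
    (hN : 1 ≤ N) (hδ : 0 < δ) (hw1 : ∀ κ l, LinReproSum N (w κ l) (Cw κ l))
    (hwE : ∀ κ l, Summable fun x => Real.exp (δ / N * l1 x) * |w κ l x|)
    (hwEb : ∀ κ l, ∑' x, Real.exp (δ / N * l1 x) * |w κ l x| ≤ c / N)
    (hA1 : ∀ c' e (μ : Fin 4), |∑' t : Pt, t μ • T c' e t| ≤ A₁ / (N : ℝ) ^ 2) (κ l a b : Fin 4) :
    (N : ℝ) ^ 6 * |t1Defect N w T Cw κ l a b| ≤ 64 * A₁ * (c * Real.exp δ / δ) := by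
  have hN1 : (1 : ℝ) ≤ N := by exact_mod_cast hN
  have hA0 : 0 ≤ A₁ := by
    have h := (abs_nonneg _).trans (hA1 a b κ)
    exact (div_nonneg_iff.mp h).elim (fun h => h.1) fun h => absurd h.2 (not_le.mpr (by positivity))
  have hc0 : 0 ≤ c := by
    have h1 : (0 : ℝ) ≤ ∑' x, Real.exp (δ / N * l1 x) * |w a b x| := tsum_nonneg fun x => by positivity
    have h2 := h1.trans (hwEb a b)
    exact (div_nonneg_iff.mp h2).elim (fun h => h.1) fun h => absurd h.2 (not_le.mpr (by positivity))
  refine (pow_six_mul_abs_t1Defect_le_of_expL1 hN hδ hw1 hwE hwEb hA1 κ l a b).trans ?_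
  rw [div_le_iff₀ (by positivity)]
  have : 0 ≤ 64 * A₁ * (c * Real.exp δ / δ) := by positivity
  nlinarith

end Letters

end Summit.QuantumFields.BalabanUV.Beta.FP.HorizontalBookkeepingCov

end
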